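import Literature.MathematicalPhysics.QuantumFieldTheory.Balaban1983to89.B1Eq324BenfattoClassSectEMemberPrecisionDoorOnLambdaStar
import Literature.MathematicalPhysics.QuantumFieldTheory.Balaban1983to89.B1Eq324BenfattoClassSectEMemberERowsAtNode00Star

/-!
# [Balaban1985UV3] (24) p. 262 ∕ [Balaban1982Higgs1] (3.24) — THE (3.24) PRECISION DOOR AT NODE 00's STAR SECT. E LETTERS AT THE TRIVIAL BACKGROUND `U = 1`,
# FOR EVERY MEMBER, WITH NO ANALYTIC ROW LEFT (seat dag-n08-b g37, INTENT-23; node N08, row `h324c` at `U = 1`)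

T. Bałaban, *Ultraviolet stability of three-dimensional lattice pure gauge field theories*, Commun. Math. Phys. **102** (1985) 255–275 [Balaban1985UV3], (24) p. 262;
*Propagators for lattice gauge theories in a background field*, CMP **99** (1985) 389–434 [Balaban1985BackgroundPropagators], Sect. E (3.155)–(3.158) pp. 427–428,
(3.132) p. 422, Cor. 3.5 p. 407; *Propagators … II*, CMP **96** (1984) 223–250 [Balaban1984PropagatorsII], Prop. 2.7 (2.149) p. 249, (2.153)–(2.156) pp. 249–250,
Lemma 2.4 p. 245, (2.3) p. 224; *(Higgs)₂,₃ quantum fields in a finite volume. I*, CMP **85** (1982) 603–636 [Balaban1982Higgs1], (3.24) p. 616; G. Benfatto et al.,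
CMP **59** (1978) 143–166 [BenfattoEtAl1978], Lemma (4.5)–(4.7) p. 152.

WHY THIS FILE.  [B10] (24) p. 262 is the cumulant bound for the Gaussian `dμ_{C^{(k)}}` of the k-th step; at NODE 00 the covariance of (3.155)–(3.158) in print units
is `(η^{d+1}C*Δ_kC)⁻¹` on the `Λ̃`-variables.  The lineage's doors at def-Y's SOURCE-convention letters left, at `U = 1`, exactly one analytic row displayed — `γ₀`
(R5′) — which CHECK-L showed unsatisfiable there at slab members (the both-good constraint index is not print's).  With def-Y's STAR EDITION (parts 1–3) and this
seat's star door chain (INTENT-20 `…PrecisionDoorAtOneStar`: reality ∕ (R3′) ∕ the `γ₀` row PROVED; INTENT-21 `…ERowsAtNode00Star`: locality ∕ column mass of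
`C_st`; INTENT-22 `…PrecisionDoorOnLambdaStar`: the generic and record-fibre doors at the star letters), EVERY row of the door at `U = 1` is a theorem of the tree:
* (R1′) symmetry of `(QG₁Q*)⁻¹(1)` — def-Y ∕ this lineage's `lettersYOfRecordV4_QG1Qinv_isSymmTr` with `Δ⁽²⁾(1) = 0`; of the `J`-letter — `D2J 1 = 0`;
* (R2′a) the P-row on STAR bonds at `U = 1` — node N06 ∕ seat n06-i's `B9Eq3132NuReadingAtOne.ineq3132Nu_one` ([4] Prop. 2.7 (2.149), coercivity (2.147)
  unconditional in the tree) read in print units between STAR bonds by seat n08-d's star-pair dictionary `…PRowDictionaryAtNode00.pRowOnΛst_of_ineq3132_nu`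
  (v1.1 p693403, §6: on a top-level bond `Lʲη = 1`, `ν(u)ν(v) = η^{d+1}`) BY NAME; (R2′b) the `J`-row at `U = 1` — seat n08-d's `JRowPrint_one_record` (all pairs);
* (R3′) `C_st(1) ∕ C_st(1)*` `trReForm`-adjoint — INTENT-20 §1 (unitary `V(1) = 1`, star pivot units `KstY_one ∕ KTstY_one`);
* (R4′) locality radius `ℓ + 2` and column mass `2` of `C_st(1)` — INTENT-21;
* (R5′) `γ₀ = (1∕(12(d+1)²))·L^{−(d+2)}` for `η^{d+1}C_st*Δ_kC_st(1)` on `Λ̃_st`-frames — INTENT-20 §3 ([4] (2.153): (2.118)-lower + Lemma 2.4 on `T^{(k)}`, this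
  lineage's `B6Ineq2118LowerMultiLevelV1` ∕ `B6Lemma24TopTorusV1` ∕ `B6Ineq2153MultiLevelV1`, `scalarRow_star`, seat n08-d's matrix lift).

WHAT IS PROVED.
* ★★★ `eq324_CsDeltaCPstY_sectEStYOfRecordV7_trBasis_one_on_unit` — **[Balaban1982Higgs1] (3.24) ∕ [Balaban1985UV3] (24) FOR print's unit-lattice Gaussian
  `𝒩(0, 𝕄_ι(η^{d+1}C_st*Δ_kC_st(1))⁻¹)` AT NODE 00's STAR LETTERS OF RECORD (`lettersYOfRecordV4 N θ M⋆ 𝔯 x`, `sectEStYOfRecordV7 N θ M⋆ 𝔢₀ x`), `U = 1`, FOR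
  EVERY MEMBER `x` above a threshold `M₆ ≤ M`, EVERY residual family `𝔯` and Sect.-E parameter family `𝔢₀`, and EVERY injective `Λ̃_st`-valued frame index `ι`**:
  the realisation on Benfatto's lattice, the small-field events, positivity of the cut-off partition functions and the cumulant bound `|log Z − Σ_{≤t} cumulants| ≤
  C·η^{κ′}·|I|` — HYPOTHESES: the numeric data of the lemma (`t, D, ϰ, p₀ > 2∕3, σ′, c, κ′ < σ′(t+1)`), `2 ≤ d + 1`, `4 ≤ ℓ`; NOTHING ELSE.

HONEST SCOPE.  Count-neutral Literature theorem, a typed composition of landed pieces; `U = 1` ONLY (the trivial background — [B9] Cor. 3.5: «for U = 1 these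
theorems are proved in [4]»; print's general-`U` rows (3.132) ∕ «methods of Sect. B» for `γ₀` are node N06's and stay displayed in INTENT-22's record edition).
What this is NOT: not the IDENT for row `h324c` (NODE 00's pin `(𝔖 k).μ = 𝒩(0, 𝕄_Λ̃(η^{d+1}C\*Δ_kC)⁻¹).map Φ` with its box ∕ class-II Hamiltonian letters ∕ window
`b₁ < b₀` is not made here), not a statement about `U ≠ 1`, not a discharge of node N06 or N08; `avYOfRecord` is def-Y's declared dictionary for `V = U_k` (exact at
`U = 1`); nothing about `d = 4` specifically, the continuum, OS axioms, a mass gap or Clay.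
-/

noncomputable section

open MeasureTheory Finset Matrix
open scoped Matrix.Norms.L2Operator

namespace Literature.MathematicalPhysics.QuantumFieldTheory.Balaban1983to89.B1Eq324BenfattoClassSectEMemberPrecisionDoorAtOneStarAssembled

open Literature.MathematicalPhysics.QuantumFieldTheory
open Literature.MathematicalPhysics.QuantumFieldTheory.Balaban1983to89.B1Eq324BenfattoLemma
open Literature.MathematicalPhysics.QuantumFieldTheory.Balaban1983to89.Node00
open B9PinMembersKLevelV1 (MemberY geo9Y bg9Y)
open B9PinGeometryKLevelV1 (unitDistY)
open B9Thm311ReadingCoords (trIP IsSymmTr)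
open B9CoReadingCoordsTranspose (trReForm TrIdx trBasis)
open B7Prop2Explicit (unitaryUnits)
open B7Prop2SpecialUnitary (specialUnitaryUnits)
open B1Eq324BenfattoClassSectEMemberPRowDictionaryAtNode00 (pRowOnΛst_of_ineq3132_nu)
open B1Eq324BenfattoClassSectEMemberRealAdjointAtNode00 (norm_trBasis_le lettersYOfRecordV4_QG1Qinv_isSymmTr)
open B1Eq324BenfattoClassSectEMemberJRowScaleAtNode00 (JRowPrint_one_record)
open B1Eq324BenfattoClassSectEMemberIneq2153ScalarReductionAtNode00 (lettersYOfRecordV4_QG1Qinv_one_eq_liftEndY)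
open B1Eq324BenfattoClassSectEMemberPrecisionDoorAtOneStar (coercive_CsDeltaCPstY_sectEStYOfRecordV7_one_frame)
open B1Eq324BenfattoClassSectEMemberPrecisionDoorOnLambdaStar (eq324_CsDeltaCstY_precision_ofRecordTC_trBasis_onΛst_on_unit)
open B1Eq324BenfattoClassSectEMemberERowsAtNode00Star (local_elimCΛstY_ofRecordTC colMass_elimCΛstY_ofRecordTC_one)

/-! ## ★★★ The (3.24) precision door at the STAR letters, `U = 1`, EVERY MEMBER — no analytic row left -/

section Door

variable {d : ℕ}

/-- ★★★ **[Balaban1982Higgs1] (3.24) ∕ [Balaban1985UV3] (24) FOR print's unit-lattice Gaussian `𝒩(0, 𝕄_ι(η^{d+1}C_st*Δ_kC_st(1))⁻¹)` AT NODE 00's STAR LETTERS OF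
RECORD, `U = 1`, FOR EVERY MEMBER — NO ANALYTIC ROW LEFT.**  For `N ≥ 1`, the numeric data of Benfatto's lemma, `2 ≤ d + 1`, `4 ≤ ℓ`, any residual family `𝔯` and
Sect.-E parameter family `𝔢₀`: there are a member threshold `M₆` and `b₁` such that for every `b₀ > b₁` there is `C ≥ 0` with, for every `η ∈ (0, 1]`, every
member `x` with `M₆ ≤ M`, and every injective frame index `ι : σ → Λ̃_st` (`lamTstY`), the three conclusions of (3.24) (realisation on Benfatto's lattice, the
small-field events, positivity + the cumulant bound `|log Z_I − cumulants_{≤t}| ≤ C η^{κ′} |I|`) for the precision matrix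
`𝕄_ι p q = Re tr(e_{p.2}ᴴ · (CsDeltaCPstY x (lettersYOfRecordV4 N θ M⋆ 𝔯 x) (sectEStYOfRecordV7 N θ M⋆ 𝔢₀ x) 1)(δ_{ι q.1} ⊗ e_{q.2})(ι p.1))`.
EVERY ROW DISCHARGED IN THE TREE: (R1′) `lettersYOfRecordV4_QG1Qinv_isSymmTr` + `Δ⁽²⁾(1) = 0`, `D2J 1 = 0`; (R2′a) `B9Eq3132NuReadingAtOne.ineq3132Nu_one` read on star
pairs (seat n08-d's `pRowOnΛst_of_ineq3132_nu`); (R2′b) `JRowPrint_one_record`; (R3′) `…PrecisionDoorAtOneStar.sum_trReForm_elimCΛstY_ofRecordTC` at `V(1) = 1` with `isUnit_KstY_one ∕ isUnit_KTstY_one`;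
(R4′) `…ERowsAtNode00Star.local_elimCΛstY_ofRecordTC ∕ colMass_elimCΛstY_ofRecordTC_one`; (R5′) `…PrecisionDoorAtOneStar.coercive_CsDeltaCPstY_sectEStYOfRecordV7_one_frame`
(`γ₀ = (1∕(12(d+1)²))·L^{−(d+2)}`).
[cite: Balaban1985UV3, (24) p.262, pp.271–272; Balaban1982Higgs1, (3.24) p.616; BenfattoEtAl1978, Lemma (4.5)–(4.7) p.152; Balaban1985BackgroundPropagators,
(3.155)–(3.158) pp.427–428, (3.132) p.422, Cor. 3.5 p.407, Thm 3.11 p.416; Balaban1984PropagatorsII, Prop. 2.7 (2.149) p.249, (2.147) p.248, (2.153)–(2.156)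
pp.249–250, Lemma 2.4 (2.128) p.245, (2.118) p.243, (2.3) p.224 (class form; bent window, presentation and coordinates ours)] -/
theorem eq324_CsDeltaCPstY_sectEStYOfRecordV7_trBasis_one_on_unit (N : ℕ) [NeZero N] (θ : Stage3Params) (hD : 2 ≤ θ.d₆ + 1) (hℓ : 4 ≤ θ.ℓ₆)
    (Mstar : ℕ) (𝔯 : ResY N θ Mstar) (𝔢₀ : SectEY N θ Mstar) (t D : ℕ) {ϰ : ℝ} (hϰ : 0 < ϰ)
    {p₀ σ' c κ' : ℝ} (hp₀ : 2 / 3 < p₀) (hσ : 0 < σ') (hc : 0 ≤ c) (hκ : 0 < κ') (hκσ : κ' < σ' * (t + 1)) :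
    ∃ M₆ b₁ : ℝ, ∀ b₀ : ℝ, b₁ < b₀ → ∃ C : ℝ, 0 ≤ C ∧ ∀ η : ℝ, 0 < η → η ≤ 1 →
      ∀ (x : MemberY θ.d₆ θ.ℓ₆ θ.hd' θ.hL' θ.b₀ θ.b₁ Mstar) [DecidableEq (IBondY x.toKIdx)], M₆ ≤ (geo9Y x).M →
      ∀ {σ : Type} [Fintype σ] [DecidableEq σ] [Nonempty σ] (ι : σ → IBondY x.toKIdx), Function.Injective ι → (∀ s, lamTstY x (ι s)) →
      ∃ (Λ : Finset (B1Eq324BenfattoLemma.Site (θ.d₆ + 1 + (θ.d₆ + 1) + 1))) (e' : σ × TrIdx N ≃ ↥Λ),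
        ((gaussianFieldOfKernel fun u w => if h : u ∈ Λ ∧ w ∈ Λ then
            ((Matrix.reindex e' e'
              (Matrix.of fun p q : σ × TrIdx N =>
                  trReForm (trBasis N p.2) (((CsDeltaCPstY x (lettersYOfRecordV4 N θ Mstar 𝔯 x)
            (sectEStYOfRecordV7 N θ Mstar 𝔢₀ x) (fun _ _ => 1)).restrictScalars ℝ)
                    (Pi.single (ι q.1) (trBasis N q.2)) (ι p.1))))⁻¹ :
                Matrix ↥Λ ↥Λ ℝ) ⟨u, h.1⟩ ⟨w, h.2⟩ else 0).map
            (fun (z : B1Eq324BenfattoLemma.Site (θ.d₆ + 1 + (θ.d₆ + 1) + 1) → ℝ) (q : σ × TrIdx N) => z ((e' q : ↥Λ) : B1Eq324BenfattoLemma.Site (θ.d₆ + 1 + (θ.d₆ + 1) + 1))) =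
          gaussianFieldOfKernel fun p q =>
            ((Matrix.of fun p q : σ × TrIdx N =>
                trReForm (trBasis N p.2) (((CsDeltaCPstY x (lettersYOfRecordV4 N θ Mstar 𝔯 x)
            (sectEStYOfRecordV7 N θ Mstar 𝔢₀ x) (fun _ _ => 1)).restrictScalars ℝ)
                  (Pi.single (ι q.1) (trBasis N q.2)) (ι p.1)))⁻¹ :
              Matrix (σ × TrIdx N) (σ × TrIdx N) ℝ) p q) ∧
        (∀ p : ℝ, 0 ≤ p →
          ((fun (z : B1Eq324BenfattoLemma.Site (θ.d₆ + 1 + (θ.d₆ + 1) + 1) → ℝ) (q : σ × TrIdx N) => z ((e' q : ↥Λ) : B1Eq324BenfattoLemma.Site (θ.d₆ + 1 + (θ.d₆ + 1) + 1))) ⁻¹'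
              {ω : σ × TrIdx N → ℝ | ∀ q, |ω q| ≤ p}) =ᵐ[gaussianFieldOfKernel fun u w => if h : u ∈ Λ ∧ w ∈ Λ then
                ((Matrix.reindex e' e'
                  (Matrix.of fun p q : σ × TrIdx N =>
                      trReForm (trBasis N p.2) (((CsDeltaCPstY x (lettersYOfRecordV4 N θ Mstar 𝔯 x)
            (sectEStYOfRecordV7 N θ Mstar 𝔢₀ x) (fun _ _ => 1)).restrictScalars ℝ)
                        (Pi.single (ι q.1) (trBasis N q.2)) (ι p.1))))⁻¹ :
                    Matrix ↥Λ ↥Λ ℝ) ⟨u, h.1⟩ ⟨w, h.2⟩ else 0]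
            smallFieldSet Λ p) ∧
        ∀ (s : ℕ) (I J : Finset (B1Eq324BenfattoLemma.Site (θ.d₆ + 1 + (θ.d₆ + 1) + 1))) (𝔞 : Coef (θ.d₆ + 1 + (θ.d₆ + 1) + 1)),
          I.Nonempty → J ⊆ I → J ⊆ Λ → coefSup s D 𝔞 J ≤ c * η ^ σ' →
          0 < ∫ z, cutoffBoltzmann (hamiltonian s D ϰ 𝔞 J) I (B10.pFun b₀ p₀ η) z ∂(gaussianFieldOfKernel fun u w => if h : u ∈ Λ ∧ w ∈ Λ then
              ((Matrix.reindex e' e'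
                (Matrix.of fun p q : σ × TrIdx N =>
                    trReForm (trBasis N p.2) (((CsDeltaCPstY x (lettersYOfRecordV4 N θ Mstar 𝔯 x)
            (sectEStYOfRecordV7 N θ Mstar 𝔢₀ x) (fun _ _ => 1)).restrictScalars ℝ)
                      (Pi.single (ι q.1) (trBasis N q.2)) (ι p.1))))⁻¹ :
                  Matrix ↥Λ ↥Λ ℝ) ⟨u, h.1⟩ ⟨w, h.2⟩ else 0) ∧
            |Real.log (∫ z, cutoffBoltzmann (hamiltonian s D ϰ 𝔞 J) I (B10.pFun b₀ p₀ η) z ∂(gaussianFieldOfKernel fun u w =>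
                if h : u ∈ Λ ∧ w ∈ Λ then
                  ((Matrix.reindex e' e'
                    (Matrix.of fun p q : σ × TrIdx N =>
                        trReForm (trBasis N p.2) (((CsDeltaCPstY x (lettersYOfRecordV4 N θ Mstar 𝔯 x)
            (sectEStYOfRecordV7 N θ Mstar 𝔢₀ x) (fun _ _ => 1)).restrictScalars ℝ)
                          (Pi.single (ι q.1) (trBasis N q.2)) (ι p.1))))⁻¹ :
                      Matrix ↥Λ ↥Λ ℝ) ⟨u, h.1⟩ ⟨w, h.2⟩ else 0)) -
              cumulantSum (gaussianFieldOfKernel fun u w => if h : u ∈ Λ ∧ w ∈ Λ then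
                  ((Matrix.reindex e' e'
                    (Matrix.of fun p q : σ × TrIdx N =>
                        trReForm (trBasis N p.2) (((CsDeltaCPstY x (lettersYOfRecordV4 N θ Mstar 𝔯 x)
            (sectEStYOfRecordV7 N θ Mstar 𝔢₀ x) (fun _ _ => 1)).restrictScalars ℝ)
                          (Pi.single (ι q.1) (trBasis N q.2)) (ι p.1))))⁻¹ :
                      Matrix ↥Λ ↥Λ ℝ) ⟨u, h.1⟩ ⟨w, h.2⟩ else 0)
                (hamiltonian s D ϰ 𝔞 J) t| ≤ C * η ^ κ' * I.card := by
  -- the `γ₀` of the star precision at `U = 1` (INTENT-20 §3), the P-row constants at `U = 1` (n06-i), the J-row constant `θ.b₁`, `m = 2`, `r = ℓ + 2`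
  have hγ₀ : 0 < 1 / (12 * (((θ.d₆ + 1 : ℕ) : ℝ)) ^ 2) * ((((θ.ℓ₆ + 1 : ℕ) : ℝ)) ^ (θ.d₆ + 2))⁻¹ := by positivity
  have hKJ : (0 : ℝ) ≤ θ.b₁ := θ.hb.1.le.trans θ.hb.2
  obtain ⟨M₆, BP, δ, hBP, hδ, H⟩ := B9Eq3132NuReadingAtOne.ineq3132Nu_one (specialUnitaryUnits (Fin N)) hℓ θ.hb.1 θ.hb.2 (θ.d₆ + 1)
    (fun x => (lettersYOfRecordV4 N θ Mstar 𝔯 x).QG1Qinv) (fun x => lettersYOfRecordV4_QG1Qinv_one_eq_liftEndY N θ Mstar 𝔯 x)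
  obtain ⟨b₁, hb₁⟩ := eq324_CsDeltaCstY_precision_ofRecordTC_trBasis_onΛst_on_unit (d := θ.d₆) N hγ₀ hBP.le hKJ hδ (m := 2 * 1) (by norm_num) t D hϰ
    hp₀ hσ hc hκ hκσ (r := (θ.ℓ₆ : ℝ) + 2)
  refine ⟨M₆, b₁, fun b₀ hb₀ => ?_⟩
  obtain ⟨C, hC, hE⟩ := hb₁ b₀ hb₀
  refine ⟨C, hC, ?_⟩
  intro η hη hηle x _ hMx σ _ _ _ ι hι hιT
  have hG : (⊥ : Subgroup (Matrix (Fin N) (Fin N) ℂ)ˣ) ≤ unitaryUnits (Matrix (Fin N) (Fin N) ℂ) := bot_le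
  have hU : ∀ μ z, (fun _ _ => 1 : CfgY (Matrix (Fin N) (Fin N) ℂ) x.toKIdx) μ z ∈ (⊥ : Subgroup (Matrix (Fin N) (Fin N) ℂ)ˣ) :=
    fun _ _ => Subgroup.one_mem _
  exact hE η hη hηle x (lettersYOfRecordV4 N θ Mstar 𝔯 x) (avYOfRecord x) (𝔢₀ x) (fun _ _ => 1) _ ι hι hιT
    (lettersYOfRecordV4_QG1Qinv_isSymmTr θ Mstar _ hG x hU (by rw [(𝔯 x).Δ2_one]; exact isSymmTr_zero _))
    (by rw [(𝔢₀ x).D2J_one]; exact isSymmTr_zero _)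
    (fun u v hu hv => pRowOnΛst_of_ineq3132_nu x (lettersYOfRecordV4 N θ Mstar 𝔯 x).QG1Qinv (θ.d₆ + 1) (θ.d₆ + 1)
      hBP.le hδ.le (bg9Y (Matrix (Fin N) (Fin N) ℂ) (specialUnitaryUnits (Fin N)) x).one (H x hMx) hu hv)
    (fun u v E _ _ => JRowPrint_one_record θ hD x (𝔢₀ x) δ u v E)
    (fun b => by rw [avYOfRecord_one, Units.val_one]; exact Submonoid.one_mem _)
    (fun c' => isUnit_KstY_one x c') (fun c' => isUnit_KTstY_one x c')
    (local_elimCΛstY_ofRecordTC x (avYOfRecord x) (𝔢₀ x) (fun _ _ => 1) ι)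
    (colMass_elimCΛstY_ofRecordTC_one x (𝔢₀ x) (fun c' => trBasis N c') norm_trBasis_le ι)
    (fun Φ hΦ => coercive_CsDeltaCPstY_sectEStYOfRecordV7_one_frame N θ Mstar 𝔯 𝔢₀ hD x ι hιT Φ hΦ)

end Door

end Literature.MathematicalPhysics.QuantumFieldTheory.Balaban1983to89.B1Eq324BenfattoClassSectEMemberPrecisionDoorAtOneStarAssembled

end
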